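import Mathlib
import Summits.AtomisticToContinuum.Crystallization.Theses.PhononSlackCertificates
import Summits.AtomisticToContinuum.Crystallization.Theorems.PhononSlackCertificatesNearFarGlueRCoverFccSharp
import Summits.AtomisticToContinuum.Crystallization.Theorems.PhononSlackCertificatesNearFarGlueRCoverHcpSharp
import Literature.Geometry.DiscreteGeometry.TwoShellPatterns
import Literature.MathematicalPhysics.StatisticalMechanics.LennardJonesClusters

/-!
# Crux `PhononSlackCertificates.NearFarGlueR` (stmt-AtomisticToContinuum-14970), line `Sketch`:
every configuration with a good particle has a tight contact

Continuation lead c4, part 4 (registered sub-goal `stub_contactExists`).  A remark on the STRENGTH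
of the registered residual `stub_tightContactGap` (the tight contact gap charges the bad particles
within `21/20` of a `1/20`-good one): the charged set is NEVER empty once a single good particle is
present.  `ascent_of_good`: a good particle `i` has, for every particle `j`, a neighbour `k` within
`21/20` that is strictly FARTHER from `x_j` than `x_i` is (sharp `2/3`-covers of the first shell,
`stub_coverFccSharp` / `stub_coverHcpSharp`, read outward instead of inward as in the descent
lemma); hence (`exists_tightContact_of_good`) if no bad particle were adjacent to a good one, the
pair (good `i`, any `j`) of maximal distance could be lengthened — so some bad particle lies within
`21/20` of a good one.  Consequently (`gap_of_good_of_tightContactGap`) the residual implies: every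
`δ`-separated finite configuration containing ONE exact-enough two-shell fcc/hcp environment has
`𝓔_LJ(x) ≥ N·e* + g₂(δ)` — finite near-ground states within `g₂` of `N·e*` contain no good particle
at all.  (Consistent with everything known: a perfect finite crystal pays its surface, `≈ 0.17`
per surface site, and the smallest good configuration, the `19`-cluster, has excess `≈ 9`.)
All `[folklore]`.
-/

noncomputable section

namespace Summit.AtomisticToContinuum.Crystallization.Theorems.PhononSlackCertificatesNearFarGlueR

open Literature.MathematicalPhysics.StatisticalMechanics
open Literature.Geometry.DiscreteGeometry
open Summit.AtomisticToContinuum.Crystallization.Theses.PhononSlackCertificates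
open scoped BigOperators RealInnerProductSpace

/-- **Ascent from a good particle.**  If `i` is `1/20`-good on the window `[47/50, 1]`, then for
every particle `j` some particle `k ≠ i` within `21/20` of `x i` is strictly farther from `x j`
than `x i` is. [folklore] -/
theorem ascent_of_good {N : ℕ} (x : Fin N → EuclideanSpace ℝ (Fin 3)) {i : Fin N}
    (hi : IsTwoShellGood (1 / 20) (47 / 50) 1 x i) (j : Fin N) :
    ∃ k : Fin N, k ≠ i ∧ dist (x k) (x i) ≤ 21 / 20 ∧ dist (x i) (x j) < dist (x k) (x j) := by
  obtain ⟨a, ha1, ha2, A, P, f, hP, hf, -, -⟩ := hi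
  have hcov : ∀ w : EuclideanSpace ℝ (Fin 3), ‖w‖ = 1 →
      ∃ v ∈ P, ‖v‖ = 1 ∧ (2 / 3 : ℝ) ≤ ⟪v, w⟫ := by
    rcases hP with rfl | rfl
    exacts [stub_coverFccSharp, stub_coverHcpSharp]
  have ha0 : 0 < a := by linarith
  -- a matched neighbour in a given pattern direction: its offset from `x i` is within `a/20` of `a • A v`
  have hnb : ∀ v ∈ P, ‖v‖ = 1 → f v ≠ i ∧ ‖x (f v) - x i - a • A v‖ ≤ a / 20 ∧
      dist (x (f v)) (x i) ≤ 21 / 20 ∧ 19 / 20 * a ≤ dist (x (f v)) (x i) := by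
    intro v hv hv1
    obtain ⟨hki, hk⟩ := hf v hv
    have hz : ‖a • A v‖ = a := by
      rw [norm_smul, Real.norm_of_nonneg ha0.le, A.norm_map, hv1, mul_one]
    have hyz : ‖x (f v) - x i - a • A v‖ ≤ a / 20 := by
      rw [dist_eq_norm, sub_add_eq_sub_sub] at hk
      linarith
    have h1 := norm_sub_norm_le (x (f v) - x i) (a • A v)
    have h2 := norm_sub_norm_le (a • A v) (x (f v) - x i)
    rw [norm_sub_rev (a • A v)] at h2
    refine ⟨hki, hyz, ?_, ?_⟩
    · rw [dist_eq_norm]; nlinarith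
    · rw [dist_eq_norm]; linarith
  by_cases hij : x j = x i
  · -- degenerate direction: any matched neighbour is farther than `0`
    set w₀ : EuclideanSpace ℝ (Fin 3) := EuclideanSpace.single (0 : Fin 3) (1 : ℝ) with hw₀
    have hw₀1 : ‖w₀‖ = 1 := by simp [hw₀]
    obtain ⟨v, hv, hv1, -⟩ := hcov w₀ hw₀1
    obtain ⟨hki, -, hd1, hd2⟩ := hnb v hv hv1
    refine ⟨f v, hki, hd1, ?_⟩
    rw [hij, dist_self]
    linarith
  · set D := dist (x i) (x j) with hD
    have hD0 : 0 < D := dist_pos.2 (Ne.symm hij)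
    set p : EuclideanSpace ℝ (Fin 3) := x i - x j with hp_def
    have hp : ‖p‖ = D := by rw [hD, dist_eq_norm]
    set u : EuclideanSpace ℝ (Fin 3) := D⁻¹ • p with hu_def
    have hu : ‖u‖ = 1 := by
      rw [hu_def, norm_smul, norm_inv, Real.norm_of_nonneg hD0.le, hp, inv_mul_cancel₀ hD0.ne']
    have hpu : ⟪p, u⟫ = D := by
      rw [hu_def, real_inner_smul_right, real_inner_self_eq_norm_sq, hp]
      field_simp
    set w : EuclideanSpace ℝ (Fin 3) := (A.toLinearIsometryEquiv rfl).symm u with hw_def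
    have hw : ‖w‖ = 1 := by rw [hw_def, LinearIsometryEquiv.norm_map, hu]
    have hAw : A w = u := by
      rw [hw_def, ← LinearIsometry.coe_toLinearIsometryEquiv A rfl]
      exact (A.toLinearIsometryEquiv rfl).apply_symm_apply u
    obtain ⟨v, hv, hv1, hvw⟩ := hcov w hw
    have hAvu : (2 / 3 : ℝ) ≤ ⟪A v, u⟫ := by
      rw [← hAw, LinearIsometry.inner_map_map]
      exact hvw
    obtain ⟨hki, hyz, hd1, -⟩ := hnb v hv hv1
    refine ⟨f v, hki, hd1, ?_⟩
    -- `⟪x k - x j, u⟫ = D + a ⟪A v, u⟫ + ⟪(x k - x i) - a • A v, u⟫ ≥ D + 2a/3 - a/20 > D`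
    have hsplit : x (f v) - x j = p + a • A v + (x (f v) - x i - a • A v) := by
      rw [hp_def]; abel
    have herr : |⟪x (f v) - x i - a • A v, u⟫| ≤ a / 20 := by
      calc |⟪x (f v) - x i - a • A v, u⟫| ≤ ‖x (f v) - x i - a • A v‖ * ‖u‖ :=
            abs_real_inner_le_norm _ _
        _ ≤ a / 20 := by rw [hu, mul_one]; exact hyz
    have herr' := (abs_le.1 herr).1
    have hinner : D + a * (2 / 3) - a / 20 ≤ ⟪x (f v) - x j, u⟫ := by
      rw [hsplit, inner_add_left, inner_add_left, hpu, real_inner_smul_left]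
      nlinarith [hAvu, ha0]
    have hcs : ⟪x (f v) - x j, u⟫ ≤ ‖x (f v) - x j‖ := by
      have := real_inner_le_norm (x (f v) - x j) u
      rwa [hu, mul_one] at this
    rw [dist_eq_norm (x (f v)) (x j)]
    linarith

/-- **Every configuration with a good particle has a tight contact**: if some particle is
`1/20`-good, then some bad particle lies within `21/20` of a good one (otherwise the pair
(good, any) of maximal distance could be lengthened by `ascent_of_good`). [folklore] -/
theorem exists_tightContact_of_good {N : ℕ} (x : Fin N → EuclideanSpace ℝ (Fin 3))
    (h : ∃ i : Fin N, IsTwoShellGood (1 / 20) (47 / 50) 1 x i) :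
    ∃ j : Fin N, ¬ IsTwoShellGood (1 / 20) (47 / 50) 1 x j ∧
      ∃ i : Fin N, IsTwoShellGood (1 / 20) (47 / 50) 1 x i ∧ dist (x i) (x j) ≤ 21 / 20 := by
  classical
  by_contra hno
  push Not at hno
  -- closure: a particle adjacent to a good particle is good
  have hclos : ∀ i k : Fin N, IsTwoShellGood (1 / 20) (47 / 50) 1 x i → dist (x i) (x k) ≤ 21 / 20 →
      IsTwoShellGood (1 / 20) (47 / 50) 1 x k := by
    intro i k hi hd
    by_contra hk
    exact absurd hd (not_le.2 (hno k hk i hi))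
  obtain ⟨i₀, hi₀⟩ := h
  set S := (Finset.univ : Finset (Fin N × Fin N)).filter fun q => IsTwoShellGood (1 / 20) (47 / 50) 1 x q.1
    with hS
  have hne : S.Nonempty := ⟨(i₀, i₀), Finset.mem_filter.2 ⟨Finset.mem_univ _, hi₀⟩⟩
  obtain ⟨q, hq, hmax⟩ := Finset.exists_max_image S (fun q => dist (x q.1) (x q.2)) hne
  have hq1 : IsTwoShellGood (1 / 20) (47 / 50) 1 x q.1 := (Finset.mem_filter.1 hq).2
  obtain ⟨k, -, hk1, hk2⟩ := ascent_of_good x hq1 q.2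
  have hkgood : IsTwoShellGood (1 / 20) (47 / 50) 1 x k := hclos q.1 k hq1 (by rw [dist_comm]; exact hk1)
  have := hmax (k, q.2) (Finset.mem_filter.2 ⟨Finset.mem_univ _, hkgood⟩)
  exact absurd this (not_le.2 hk2)

/-- Hence the count of tight contacts is at least one as soon as a good particle is present.
[folklore] -/
theorem one_le_card_tightContact_of_good {N : ℕ} (x : Fin N → EuclideanSpace ℝ (Fin 3))
    (h : ∃ i : Fin N, IsTwoShellGood (1 / 20) (47 / 50) 1 x i) :
    (1 : ℝ) ≤ (Nat.card {j : Fin N // ¬ IsTwoShellGood (1 / 20) (47 / 50) 1 x j ∧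
      ∃ i : Fin N, IsTwoShellGood (1 / 20) (47 / 50) 1 x i ∧ dist (x i) (x j) ≤ 21 / 20} : ℝ) := by
  obtain ⟨j, hj, i, hi, hd⟩ := exists_tightContact_of_good x h
  haveI : Nonempty {j : Fin N // ¬ IsTwoShellGood (1 / 20) (47 / 50) 1 x j ∧
      ∃ i : Fin N, IsTwoShellGood (1 / 20) (47 / 50) 1 x i ∧ dist (x i) (x j) ≤ 21 / 20} :=
    ⟨⟨j, hj, i, hi, hd⟩⟩
  exact_mod_cast (Nat.card_pos (α := {j : Fin N // ¬ IsTwoShellGood (1 / 20) (47 / 50) 1 x j ∧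
      ∃ i : Fin N, IsTwoShellGood (1 / 20) (47 / 50) 1 x i ∧ dist (x i) (x j) ≤ 21 / 20}))

/-- **The residual charges every configuration that contains a good particle.**  If the registered
residual holds, then for every `δ > 0` some `g₂ > 0` has `N·e* + g₂ ≤ 𝓔_LJ(x)` for every
`δ`-separated finite configuration with at least one `1/20`-good particle: finite configurations
within `g₂` of `N·e*` contain no exact-enough two-shell fcc/hcp environment at all. [folklore] -/
theorem gap_of_good_of_tightContactGap
    (h : ∀ δ : ℝ, 0 < δ → ∃ g₂ : ℝ, 0 < g₂ ∧ ∀ (N : ℕ) (x : Fin N → EuclideanSpace ℝ (Fin 3)),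
      (∀ i j : Fin N, i ≠ j → δ ≤ dist (x i) (x j)) →
      (N : ℝ) * (⨅ Q : PeriodicConfiguration 3, Q.energyPerParticle lennardJones)
        + g₂ * (Nat.card {j : Fin N // ¬ IsTwoShellGood (1 / 20) (47 / 50) 1 x j ∧
            ∃ i : Fin N, IsTwoShellGood (1 / 20) (47 / 50) 1 x i ∧ dist (x i) (x j) ≤ 21 / 20} : ℝ)
        ≤ interactionEnergy lennardJones x) :
    ∀ δ : ℝ, 0 < δ → ∃ g₂ : ℝ, 0 < g₂ ∧ ∀ (N : ℕ) (x : Fin N → EuclideanSpace ℝ (Fin 3)),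
      (∀ i j : Fin N, i ≠ j → δ ≤ dist (x i) (x j)) →
      (∃ i : Fin N, IsTwoShellGood (1 / 20) (47 / 50) 1 x i) →
      (N : ℝ) * (⨅ Q : PeriodicConfiguration 3, Q.energyPerParticle lennardJones) + g₂ ≤
        interactionEnergy lennardJones x := by
  intro δ hδ
  obtain ⟨g₂, hg₂, H⟩ := h δ hδ
  refine ⟨g₂, hg₂, fun N x hsep hgood => ?_⟩
  have h1 := one_le_card_tightContact_of_good x hgood
  have h2 := H N x hsep
  nlinarith [mul_le_mul_of_nonneg_left h1 hg₂.le]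

/-- **Registered sub-goal `stub_contactExists` of the crux item** (skeleton `Lines/Sketch.lean`,
c4): every configuration with a good particle has a tight contact — `exists_tightContact_of_good`
in closed form. [folklore] -/
theorem stub_contactExists :
    ∀ (N : ℕ) (x : Fin N → EuclideanSpace ℝ (Fin 3)),
      (∃ i : Fin N, IsTwoShellGood (1 / 20) (47 / 50) 1 x i) →
      ∃ j : Fin N, ¬ IsTwoShellGood (1 / 20) (47 / 50) 1 x j ∧
        ∃ i : Fin N, IsTwoShellGood (1 / 20) (47 / 50) 1 x i ∧ dist (x i) (x j) ≤ 21 / 20 :=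
  fun _ x h => exists_tightContact_of_good x h

end Summit.AtomisticToContinuum.Crystallization.Theorems.PhononSlackCertificatesNearFarGlueR

end
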